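import Summits.BirchSwinnertonDyer.BirchSwinnertonDyer.Theorems.ErratumRoadFiveNonSurjCornerKolyJLevelOneAvatar
import Summits.BirchSwinnertonDyer.BirchSwinnertonDyer.Theorems.ErratumRoadFiveNonSurjCornerKolyJLevelTransport
import Summits.BirchSwinnertonDyer.BirchSwinnertonDyer.Theorems.ErratumRoadFiveNonSurjCornerKolyJProp44StandingInputs
import Summits.BirchSwinnertonDyer.BirchSwinnertonDyer.Theorems.Rank1ResidualJetThm63KernelInputsV3
import Summits.BirchSwinnertonDyer.BirchSwinnertonDyer.Theorems.Rank1ResidualJetCompatibleDataDown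
import Summits.BirchSwinnertonDyer.BirchSwinnertonDyer.Theorems.Rank1ResidualJetRingClassFields
import Summits.BirchSwinnertonDyer.BirchSwinnertonDyer.Theorems.ClassRecordThreeEulerHalvesAtThreeWalkSupplyRootTransverse
import Summits.BirchSwinnertonDyer.Rank1Residual.JET.CarrierEndFormsGross1991
import Summits.BirchSwinnertonDyer.Rank1Residual.X11b.KolyvaginClassChoiceConcrete
import Literature.NumberTheory.EllipticCurves.McCallum1991.KolyvaginClassesLocalOrderComparison
import HarnessLib

/-!
# T1 JET (cell `bsd-jet`), road K, Ш-half of Jetchev Cor. 1.5 at `p ∣ N` — the DIVIDED Kolyvagin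
# classes `c̃(n) = c_p(P_n ∕ p^{M₀}) ∈ H¹(K, E[p])` (Kolyvagin primes of index `≥ M₀ + 1`) with Gross's
# Props. 5.4 (2), 6.2 (1), 6.2 (2): the `h1` input of the divided descent

HONEST FRAMING (programme file `BSD-LIT2PART-PROGRAMME-v1.md` §HONESTY, verbatim): «no tranche here
proves BSD; ARM L moves the LITERAL column of an r ≤ 1 census into the kernel-proved-modulo-named-print
column.» THEOREMS ONLY (seat `bsd-jet-pv-1`, session g9; `--supports stmt-BirchSwinnertonDyer-14418`,
helper); nothing is booked; 0 classes move. CONDITIONAL on two named Literature facts, displayed: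
`McCallum1991.prop44_localOrder_kolyvaginClass_mul_eq` (`h44`, [McC] Prop. 4.4) and
`Gross1991_heegnerPoint_sub_ratTorsion_mem_E0` (`hF1`, [GZ86 III (3.1)] as Gross 1991 §6 uses it).

WHAT. Under McCallum's GLOBAL DIVISIBILITY hypothesis at depth `M₀` — every derived Heegner point `P_n`
(`n` square-free, all prime factors Zhang–Kolyvagin primes of index `≥ M₀`) is `p^{M₀}`-divisible in
`E(K[n])`, the conclusion of Jetchev's Thm. 1.4 (road K: `JET.JetchevDivisibilityCarrier*`) — the
points `x_n := P_n ∕ p^{M₀}` (unique: `E(K[n])` has no `p`-torsion) carry Kolyvagin classes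
`c̃(n) := c_p(x_n) ∈ H¹(K, E[p])` (stepL corner-p1's LEVEL-`p` AVATARS, `Koly.exists_levelOne_avatar`:
`ι_* c̃(n) = c_{M₀+1}(n)`, `c̃(n) = 0 ↔ p^{M₀+1} ∣ P_n`) for every square-free `n` whose prime factors
are Kolyvagin primes of index `≥ M₀ + 1`. This file proves for them the three leaf properties of
Gross's §10 (the `h1` input of `JET.DividedDescent.exists_hypotheses_of_localData_of_kol`), each by
TRANSPORT along the injective change of level `ι_* : H¹(K, E[p]) → H¹(K, E[p^{M₀+1}])` from the
corresponding kernel theorem about `c_{M₀+1}(n)`: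
* Prop. 5.4 (2) (sign `−w(E)·(−1)^{ω(n)}`): `JET.sign_conjAct_kolyvaginClass` (pv-2, unconditional) +
  `Theorems.conjAct_eq_smul_of_torsionH1OfDvd`;
* Prop. 6.2 (1) (Kummer condition at every place not over `n`): pv-2's
  `localization_kolyvaginClass_mem_kummerSelmerStructure_of_GZ31_kolyvagin` ⟸ `hF1`
  (`JET.forall_hGZ_of_Gross1991`) + `Theorems.mem_selmerLocalKer_iff_torsionH1OfDvd_mem`;
* Prop. 6.2 (2) at `λ ∣ n` (`c̃(n)` Kummer at `λ` ↔ `c̃(n/ℓ)_λ = 0`): `h44` at level `p^{M₀+1}` on a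
  DOWN-compatible pair (`JET.exists_compatible_datum_of_dvd_of_grossCM`, pv-1 g8), choice
  independence at conductor `n/ℓ` (x11b3 `KolyvaginChoice.zsmul_kolyvaginClass_mem_iff`), and the
  local injectivity of `ι_*` at `λ` (`Theorems.mem_torsionLocalKer_iff_torsionH1OfDvd_mem`, `Γ_{K_λ}`
  fixes `E[p^{M₀+1}]`: `Walk.resGal_adicCompletion_smul_torsion_eq_self`).
The data at each conductor are CHOSEN per level (Gross 1991 §3 CM facts, PROVED:
`nonempty_kolyvaginHeegnerData_of_grossCM`), the given `d₁` at conductor `1`.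
References: [cite: GrossLMS1991, §4 (4.4), Props. 5.4 (2), 6.2, §10] [cite: McCallumLMS1991, §4 (6),
Prop. 4.4, Lemma 4.6, §5 Lemma 5.1, Cor. 5.6] [cite: Jetchev2008, §3.1 item 7, Cor. 1.5 (p. 812)]
[cite: GrossZagier1986, III (3.1)]. Design: no definitions; `K : Type`.
Axioms: `propext`, `Classical.choice`, `Quot.sound`.
-/

set_option autoImplicit false

noncomputable section

open scoped Classical NumberField

open WeierstrassCurve IsDedekindDomain NumberField Field Literature.NumberTheory.EllipticCurves
  Literature.NumberTheory.EllipticCurves.ModularForms Literature.NumberTheory.EllipticCurves.Jetchev2008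
  Literature.NumberTheory.GaloisRepresentations
  Literature.NumberTheory.EllipticCurves.KolyvaginCocycle
  Literature.NumberTheory.EllipticCurves.RingClassField
  Summit.BirchSwinnertonDyer.Rank1Residual.X11b Summit.BirchSwinnertonDyer.Rank1Residual.X11b.Three
  Summit.BirchSwinnertonDyer.Rank1Residual.X11b.Three.Koly
  Summit.BirchSwinnertonDyer.BirchSwinnertonDyer

namespace Summit.BirchSwinnertonDyer.Rank1Residual.JET.DividedDescent

variable {K : Type} [Field K] [NumberField K] {W : WeierstrassCurve ℚ}

/-- `p^1 ∣ p^{M₀+1}` in `ℤ` (the change of level along which the avatars are transported). [folklore] -/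
theorem levelOne_dvd (p M₀ : ℕ) : ((p ^ 1 : ℕ) : ℤ) ∣ ((p ^ (M₀ + 1) : ℕ) : ℤ) := by
  exact_mod_cast pow_dvd_pow p (Nat.le_add_left 1 M₀)

/-- **`ι_* : H¹(K, E[p]) → H¹(K, E[p^{M₀+1}])` is injective** (`K` imaginary quadratic, `p` odd,
`ρ̄_{E,p}` onto: `E(K)[p] = 0`) — stepL shim's `torsionH1OfDvd_pow_injective` at `(1, M₀)`, with the
exponent rewritten `1 + M₀ = M₀ + 1`. [cite: McCallumLMS1991, §4 Lemma 4.6] [cite: GrossLMS1991, Lemma 4.3] -/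
theorem torsionH1OfDvd_levelOne_injective [W.IsElliptic] (hK : IsImaginaryQuadratic K) {p : ℕ}
    (hp : p.Prime) (hp2 : p ≠ 2) (hρ : W.HasSurjectiveModNGaloisRep p) (M₀ : ℕ) :
    Function.Injective (torsionH1OfDvd (W.baseChange K) (levelOne_dvd p M₀)) := by
  have e : M₀ + 1 = 1 + M₀ := Nat.add_comm _ _
  suffices h : ∀ hd : ((p ^ 1 : ℕ) : ℤ) ∣ ((p ^ (M₀ + 1) : ℕ) : ℤ),
      Function.Injective (torsionH1OfDvd (W.baseChange K) hd) from h _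
  rw [e]
  intro hd
  exact Theorems.torsionH1OfDvd_pow_injective W hK hp hp2 hρ 1 M₀

omit [NumberField K] in
/-- A finite place not containing `m` lies over no prime factor of `m`. [folklore] -/
theorem not_placeOver_inr_of_not_mem {m : ℕ} {v : HeightOneSpectrum (𝓞 K)}
    (hv : (m : 𝓞 K) ∉ v.asIdeal) {ℓ : ℕ} (hℓ : ℓ ∈ m.primeFactors) :
    ¬ Jetchev2008.PlaceOver K (Sum.inr v) ℓ := by
  rintro ⟨𝔳, h𝔳, hℓ𝔳⟩
  have h : 𝔳 = v := (Sum.inr_injective h𝔳).symm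
  subst h
  obtain ⟨k, hk⟩ := Nat.dvd_of_mem_primeFactors hℓ
  apply hv
  rw [hk, Nat.cast_mul]
  exact 𝔳.asIdeal.mul_mem_right _ hℓ𝔳

omit [NumberField K] in
/-- An infinite place lies over no prime. [folklore] -/
theorem not_placeOver_inl (w : InfinitePlace K) (ℓ : ℕ) : ¬ Jetchev2008.PlaceOver K (Sum.inl w) ℓ := by
  rintro ⟨𝔳, h𝔳, -⟩
  exact Sum.inl_ne_inr h𝔳

/-- **The divided Kolyvagin classes and their three leaf properties (Gross Props. 5.4 (2), 6.2 (1),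
6.2 (2)) at level `p`, for Kolyvagin primes of index `≥ M₀ + 1`** — the `h1` input of
`exists_hypotheses_of_localData_of_kol` at `n = p^1`, together with the base class `y = c̃(1)`:
`ι_* y = c_{M₀+1}(1)` (McCallum's class of `P_1 = y_K`) and `y = 0 ↔ p^{M₀+1} ∣ P_1` in `E(K[1])`.
Frame: `E/ℚ` globally minimal non-CM, `K` imaginary quadratic with `d_K ∉ {−3,−4}` and the Heegner
hypothesis for `N = N_E`, `p` odd with the `p`-adic tower onto, `c ≠ 1` in `Aut(K/ℚ)`, `(Dt, β, ι)`
with a conductor-`1` datum `d₁`, and McCallum's global divisibility to depth `M₀`. CONDITIONAL on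
`h44` ([McC] Prop. 4.4) and `hF1` ([GZ86 III (3.1)]). See the module docstring for the proof.
[cite: GrossLMS1991, §4 (4.4), Props. 5.4 (2), 6.2] [cite: McCallumLMS1991, §4 (6), Prop. 4.4, Lemma 4.6]
[cite: Jetchev2008, §3.1 item 7] [cite: GrossZagier1986, III (3.1)] -/
theorem exists_dividedClasses [W.IsElliptic] [W.IsGloballyMinimal] [NeZero (W.conductorNorm ℤ)]
    (hcm : ¬ W.HasCM) (hK : IsImaginaryQuadratic K)
    (hD3 : NumberField.discr K ≠ -3) (hD4 : NumberField.discr K ≠ -4)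
    (hH : SatisfiesHeegnerHypothesis (W.conductorNorm ℤ) K)
    {p : ℕ} [Fact p.Prime] (hp2 : p ≠ 2) (htower : ∀ n : ℕ, W.HasSurjectiveModNGaloisRep (p ^ n : ℕ))
    (h44 : McCallum1991.prop44_localOrder_kolyvaginClass_mul_eq)
    (hF1 : Gross1991_heegnerPoint_sub_ratTorsion_mem_E0)
    (c : K ≃ₐ[ℚ] K) (hc : c ≠ 1)
    (Dt : ModularParametrizationData W (W.conductorNorm ℤ)) (β : ℤ) (ι : K →+* ℂ)
    (d₁ : KolyvaginHeegnerData Dt β ι 1) (M₀ : ℕ)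
    (hdivM₀ : ∀ (n : ℕ) (d : KolyvaginHeegnerData Dt β ι n), Squarefree n →
      (∀ ℓ ∈ n.primeFactors, Zhang2014.IsKolyvaginPrime (W.conductorNorm ℤ) W K p ℓ ∧
        M₀ ≤ Zhang2014.kolyvaginIndex W p ℓ) → PDiv d p M₀) :
    ∃ (y : galH1Torsion (W.baseChange K) ((p ^ 1 : ℕ) : ℤ)) (ε : ℤ)
      (cl : ℕ → galH1Torsion (W.baseChange K) ((p ^ 1 : ℕ) : ℤ)),
      torsionH1OfDvd (W.baseChange K) (levelOne_dvd p M₀) y =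
          d₁.kolyvaginClass (Fact.out : p.Prime) (M₀ + 1) ∧
      (y = 0 ↔ PDiv d₁ p (M₀ + 1)) ∧
      (ε = 1 ∨ ε = -1) ∧ cl 1 = y ∧
      ∀ m : ℕ, Squarefree m →
        (∀ q ∈ m.primeFactors, IsKolyvaginPrime (W.conductorNorm ℤ) W K p q ∧
          FrobEqFrobInfty W K (p ^ (M₀ + 1)) q ∧
          Zhang2014.IsKolyvaginPrime (W.conductorNorm ℤ) W K p q ∧
          M₀ + 1 ≤ Zhang2014.kolyvaginIndex W p q) →
        conjAct W c ((p ^ 1 : ℕ) : ℤ) (cl m) = (ε * (-1) ^ m.primeFactors.card) • cl m ∧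
        (∀ v : HeightOneSpectrum (𝓞 K), (m : 𝓞 K) ∉ v.asIdeal →
          cl m ∈ selmerLocalKer (W.baseChange K) (v.adicCompletion K) ((p ^ 1 : ℕ) : ℤ)) ∧
        (∀ w : InfinitePlace K,
          cl m ∈ selmerLocalKer (W.baseChange K) w.Completion ((p ^ 1 : ℕ) : ℤ)) ∧
        (∀ ℓ : ℕ, ℓ.Prime → ℓ ∣ m → ∀ v : HeightOneSpectrum (𝓞 K), (ℓ : 𝓞 K) ∈ v.asIdeal →
          (cl m ∈ selmerLocalKer (W.baseChange K) (v.adicCompletion K) ((p ^ 1 : ℕ) : ℤ) ↔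
            cl (m / ℓ) ∈
              (W.baseChange K).torsionLocalKer (v.adicCompletion K) ((p ^ 1 : ℕ) : ℤ))) := by
  have hp : p.Prime := Fact.out
  have hρ : W.HasSurjectiveModNGaloisRep p := by simpa using htower 1
  set N : ℕ := W.conductorNorm ℤ with hNdef
  have hD : NumberField.discr K < -4 := KolyvaginAssembly.discr_lt_neg_four hK ⟨hD3, hD4⟩
  have hND : IsCoprime (N : ℤ) (NumberField.discr K) :=
    KolyvaginAssembly.isCoprime_discr_of_satisfiesHeegnerHypothesis hK hH
  have hCM1 : phi_heegnerPointOfConductor_mem_range_map_ringClassField N W K :=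
    phi_heegnerPointOfConductor_mem_range_map_ringClassField_holds N W K
  have hCM2 : exists_generator_ringClassGalOver K := exists_generator_ringClassGalOver_holds
  haveI : ∀ j : ℕ, NumberField (ringClassField K ι j) := fun j ↦ numberField_ringClassField K hK ι j
  have hM : 1 ≤ M₀ + 1 := by omega
  have hinj := torsionH1OfDvd_levelOne_injective (W := W) hK hp hp2 hρ M₀
  -- [GZ86 III (3.1)] receptacle schema at Kolyvagin conductors, from F1
  obtain ⟨n', hcop', hGZ⟩ := forall_hGZ_of_Gross1991 hF1 W K hK hD3 hD4 hH p hp2 hρ Dt β ι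
  -- ### the admissible conductors: square-free products of Kolyvagin primes of index `≥ M₀ + 1`
  let KS : ℕ → Prop := fun m ↦ Squarefree m ∧ ∀ q ∈ m.primeFactors,
    IsKolyvaginPrime N W K p q ∧ FrobEqFrobInfty W K (p ^ (M₀ + 1)) q ∧
      Zhang2014.IsKolyvaginPrime N W K p q ∧ M₀ + 1 ≤ Zhang2014.kolyvaginIndex W p q
  have hKS1 : KS 1 := ⟨squarefree_one, fun q hq ↦ by simp at hq⟩
  have hKSdvd : ∀ {m k : ℕ}, KS m → k ∣ m → KS k := fun {m k} h hk ↦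
    ⟨h.1.squarefree_of_dvd hk, fun q hq ↦ h.2 q (Nat.primeFactors_mono hk h.1.ne_zero hq)⟩
  have hZ : ∀ m, KS m → ∀ q ∈ m.primeFactors,
      Zhang2014.IsKolyvaginPrime N W K p q ∧ M₀ + 1 ≤ Zhang2014.kolyvaginIndex W p q :=
    fun m h q hq ↦ ⟨(h.2 q hq).2.2.1, (h.2 q hq).2.2.2⟩
  have hZ' : ∀ m, KS m → ∀ q ∈ m.primeFactors, Zhang2014.IsKolyvaginPrime N W K p q :=
    fun m h q hq ↦ (h.2 q hq).2.2.1
  have hG : ∀ m, KS m → ∀ q ∈ m.primeFactors,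
      IsKolyvaginPrime N W K p q ∧ FrobEqFrobInfty W K (p ^ (M₀ + 1)) q :=
    fun m h q hq ↦ ⟨(h.2 q hq).1, (h.2 q hq).2.1⟩
  have hinert : ∀ m, KS m → ∀ q ∈ m.primeFactors, (Ideal.span {(q : 𝓞 K)}).IsPrime :=
    fun m h q hq ↦ (h.2 q hq).2.2.1.2.2.2.2.1
  -- ### data at every admissible conductor (Gross §3, PROVED), the given `d₁` at conductor `1`
  have hne : ∀ m, KS m → Nonempty (KolyvaginHeegnerData Dt β ι m) := fun m h ↦
    BirchSwinnertonDyer.Theorems.nonempty_kolyvaginHeegnerData_of_grossCM hCM1 hCM2 hK hH Dt β ι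
      d₁.dvd_sq_sub h.1 (hinert m h)
  let D : (m : ℕ) → KS m → KolyvaginHeegnerData Dt β ι m := fun m h ↦
    if h1 : m = 1 then h1 ▸ d₁ else (hne m h).some
  have hD1 : D 1 hKS1 = d₁ := by simp [D]
  -- ### standing inputs at level `p^{M₀+1}` and the divisibility `p^{M₀} ∣ P_m`
  have hA : ∀ (m : ℕ) (h : KS m) (k : ℕ),
      IsAdmissible (absoluteGaloisGroup K) (D m h).pointsSubgroup ((p ^ k : ℕ) : ℤ) :=
    fun m h k ↦ RingClassNoTorsion.isAdmissible_pointsSubgroup _ hK h.1.ne_zero hp hp2 hρ k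
  have hP : ∀ (m : ℕ) (h : KS m), (D m h).toGeomPoints (D m h).derivedPoint ∈
      invPoints (absoluteGaloisGroup K) (D m h).pointsSubgroup ((p ^ (M₀ + 1) : ℕ) : ℤ) :=
    fun m h ↦ Theorems.Prop44.toGeomPoints_derivedPoint_mem_invPoints hK ι hD hH Dt hp h.1 (hZ m h)
      (D m h)
  have hdv : ∀ (m : ℕ) (h : KS m), PDiv (D m h) p M₀ := fun m h ↦
    hdivM₀ m (D m h) h.1 (fun q hq ↦ ⟨(hZ m h q hq).1, Nat.le_of_succ_le (hZ m h q hq).2⟩)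
  -- ### the level-`p` avatars `c̃(m) = c_p(P_m ∕ p^{M₀})`
  have hav : ∀ (m : ℕ) (h : KS m), ∃ κb : galH1Torsion (W.baseChange K) ((p ^ 1 : ℕ) : ℤ),
      torsionH1OfDvd (W.baseChange K) (levelOne_dvd p M₀) κb = (D m h).kolyvaginClass hp (M₀ + 1) ∧
        (κb = 0 ↔ PDiv (D m h) p (M₀ + 1)) :=
    fun m h ↦ Koly.exists_levelOne_avatar (D m h) hp M₀ (hA m h (M₀ + 1)) (hP m h) (hdv m h)
  choose κb hκ using hav
  let cl : ℕ → galH1Torsion (W.baseChange K) ((p ^ 1 : ℕ) : ℤ) := fun m ↦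
    if h : KS m then κb m h else 0
  have hcl : ∀ (m : ℕ) (h : KS m), cl m = κb m h := fun m h ↦ dif_pos h
  -- ### Kummer condition of `c_{M₀+1}(m)` at every place not over `m` ([GZ86 III (3.1)] ⟸ F1)
  have hkum : ∀ (m : ℕ) (h : KS m) (v : Place K), (∀ ℓ ∈ m.primeFactors, ¬ Jetchev2008.PlaceOver K v ℓ) →
      (D m h).kolyvaginClass hp (M₀ + 1) ∈
        selmerLocalKer (W.baseChange K) (Place.Completion v) ((p ^ (M₀ + 1) : ℕ) : ℤ) := by
    intro m h v hv
    have hk := localization_kolyvaginClass_mem_kummerSelmerStructure_of_GZ31_kolyvagin hK hD3 hD4 hH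
      hp2 hρ Dt β ι hcop' hGZ h.1 (k := M₀ + 1) (hZ m h) (D m h) v hv
    have hk' : (D m h).kolyvaginClass hp (M₀ + 1) ∈
        ((W.baseChange K).kummerSelmerStructure ((p ^ (M₀ + 1) : ℕ) : ℤ) v).comap
          (galoisCohomology.localization ((W.baseChange K).torsionGaloisModule ((p ^ (M₀ + 1) : ℕ) : ℤ))
            v 1) := hk
    rw [(W.baseChange K).comap_localization_kummerSelmerStructure] at hk'
    exact hk'
  -- ### `Γ_{K_λ}` fixes `E[p^{M₀+1}]` at the place of a Kolyvagin prime of index `≥ M₀ + 1`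
  have htriv : ∀ {ℓ : ℕ}, Zhang2014.IsKolyvaginPrime N W K p ℓ → M₀ + 1 ≤ Zhang2014.kolyvaginIndex W p ℓ →
      ∀ (v : HeightOneSpectrum (𝓞 K)), (ℓ : 𝓞 K) ∈ v.asIdeal →
      ∀ (g : absoluteGaloisGroup (v.adicCompletion K))
        (Q : geomTorsion (W.baseChange K) ((p ^ (M₀ + 1) : ℕ) : ℤ)),
        resGal (K := K) (v.adicCompletion K) g • Q = Q :=
    fun hℓ hidx v hv ↦ Walk.resGal_adicCompletion_smul_torsion_eq_self W hK hℓ hidx v hv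
  refine ⟨κb 1 hKS1, -W.rootNumber, cl, ?_, ?_, ?_, (hcl 1 hKS1), ?_⟩
  · -- `ι_* y = c_{M₀+1}(1)` for the given `d₁`
    have h := (hκ 1 hKS1).1
    rwa [hD1] at h
  · have h := (hκ 1 hKS1).2
    rwa [hD1] at h
  · rcases W.rootNumber_eq_one_or with h1 | h1 <;> simp [h1]
  intro m hm hkol
  have h : KS m := ⟨hm, hkol⟩
  refine ⟨?_, ?_, ?_, ?_⟩
  · -- ### Prop. 5.4 (2): the sign, transported from `c_{M₀+1}(m)`
    have hs := (sign_conjAct_kolyvaginClass hK hD3 hD4 hH hp2 hρ c hc Dt β ι hm (k := M₀ + 1) hM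
      (hZ m h) (D m h)).2
    rw [hcl m h]
    refine Theorems.conjAct_eq_smul_of_torsionH1OfDvd W c (levelOne_dvd p M₀) hinj _ (κb m h) ?_
    rw [(hκ m h).1]
    exact hs
  · -- ### Prop. 6.2 (1), finite places not dividing `m`
    intro v hv
    rw [hcl m h, Theorems.mem_selmerLocalKer_iff_torsionH1OfDvd_mem (W.baseChange K)
      (v.adicCompletion K) (levelOne_dvd p M₀), (hκ m h).1]
    exact hkum m h (Sum.inr v) (fun ℓ hℓ ↦ not_placeOver_inr_of_not_mem hv hℓ)
  · -- ### Prop. 6.2 (1), infinite places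
    intro w
    rw [hcl m h, Theorems.mem_selmerLocalKer_iff_torsionH1OfDvd_mem (W.baseChange K)
      w.Completion (levelOne_dvd p M₀), (hκ m h).1]
    exact hkum m h (Sum.inl w) (fun ℓ _ ↦ not_placeOver_inl w ℓ)
  · -- ### Prop. 6.2 (2) at `λ ∣ m`: `h44` on a compatible pair + choice independence + transport
    intro ℓ hℓ hℓm v hv
    obtain ⟨m₁, rfl⟩ : ∃ m₁, m = m₁ * ℓ := ⟨m / ℓ, (Nat.div_mul_cancel hℓm).symm⟩
    rw [Nat.mul_div_cancel m₁ hℓ.pos]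
    have h₁ : KS m₁ := hKSdvd h (Dvd.intro ℓ rfl)
    have hℓm₁ : ¬ ℓ ∣ m₁ := fun hd ↦ by
      have hsq := hm
      rw [Nat.squarefree_mul_iff] at hsq
      exact hℓ.one_lt.ne' (Nat.Coprime.eq_one_of_dvd (hsq.1.symm) hd |>.symm ▸ rfl)
    have hℓkol := hkol ℓ (Nat.mem_primeFactors.mpr ⟨hℓ, Dvd.intro_left m₁ rfl, hm.ne_zero⟩)
    rw [hcl (m₁ * ℓ) h, hcl m₁ h₁,
      Theorems.mem_selmerLocalKer_iff_torsionH1OfDvd_mem (W.baseChange K) (v.adicCompletion K)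
        (levelOne_dvd p M₀), (hκ (m₁ * ℓ) h).1,
      Theorems.mem_torsionLocalKer_iff_torsionH1OfDvd_mem (W.baseChange K) (v.adicCompletion K)
        (pow_dvd_pow p (Nat.le_add_left 1 M₀)) (pow_ne_zero 1 hp.ne_zero)
        (pow_ne_zero (M₀ + 1) hp.ne_zero) (htriv hℓkol.2.2.1 hℓkol.2.2.2 v hv), (hκ m₁ h₁).1]
    -- a datum at `m₁` compatible DOWN from the chosen datum at `m₁ ℓ`
    obtain ⟨d'', hσ, hS, hS', hemb⟩ := exists_compatible_datum_of_dvd_of_grossCM hK hD hH p Dt β ι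
      hm (hZ' (m₁ * ℓ) h) (Dvd.intro ℓ rfl) (D (m₁ * ℓ) h)
    have h44a := McCallum1991.kolyvaginClass_mul_mem_selmerLocalKer_iff_of_prop44 h44 W hcm K hK
      hD3 hD4 hH p hp2 htower Dt β ι (M₀ + 1) hM m₁ ℓ hm hℓ hℓm₁ (hZ (m₁ * ℓ) h) d'' (D (m₁ * ℓ) h)
      hσ hS hS' hemb v hv
    have h44b := McCallum1991.kolyvaginClass_mul_mem_torsionLocalKer_iff_of_prop44 h44 W hcm K hK
      hD3 hD4 hH p hp2 htower Dt β ι (M₀ + 1) hM m₁ ℓ hm hℓ hℓm₁ (hZ (m₁ * ℓ) h) d'' (D (m₁ * ℓ) h)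
      hσ hS hS' hemb v hv
    rw [h44a, h44b]
    -- choice independence at conductor `m₁`: `d''` versus the chosen `D m₁`
    let fam : (k : ℕ) → k ∣ m₁ → KolyvaginHeegnerData Dt β ι k := fun k hk ↦
      if e : k = m₁ then e ▸ D m₁ h₁ else (hne k (hKSdvd h₁ hk)).some
    have hfam : fam m₁ dvd_rfl = D m₁ h₁ := by simp [fam]
    have hB := KolyvaginChoice.zsmul_kolyvaginClass_mem_iff hK ι Dt hp hM hND hD h₁.1 (hG m₁ h₁) fam
      dvd_rfl d'' (by rw [hfam]; exact hA m₁ h₁ (M₀ + 1))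
      ((W.baseChange K).torsionLocalKer (v.adicCompletion K) ((p ^ (M₀ + 1) : ℕ) : ℤ)) 1
    rw [one_zsmul, one_zsmul, hfam] at hB
    exact hB

end Summit.BirchSwinnertonDyer.Rank1Residual.JET.DividedDescent

end
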